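import Literature.Computability.Cryptography.LWEGuessTestAnswers
import Literature.Computability.Cryptography.LWEGuessTestQuery
import Literature.Computability.Cryptography.BLPRSMachineTestLaw
import HarnessLib

/-!
# The h₃ machine's rate-guess test, V: the record programs run against a decision algorithm sample `machTest`

Topic `Computability/Cryptography` (LWE), grouping namespace `BLPRS2013.KProg`; sequel of `LWEGuessTestAnswers.lean` (closed forms: on uniform coins the
verdict has the law `flatGuessTest (decKernel dec ℓ) …`), `LWEGuessTestQuery.lean` (the programs `tQuery`, `tVerdictOf` against a record) and
`BLPRSMachineTestLaw.lean` (`machTest q m₃ c cD c₃ n K`: the machine's estimate-and-flag test at the level of laws). This file fixes the GENUINE test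
record of level `n` and proves that the programs, run with the decision of a given algorithm `D₃` on its own coins as the answers, sample exactly
`machTest … (oracleLWEDistinguisher D₃ O coins₃ fuel₃ n (q n) (m₃ n))` (everything PROVED; definitions with bodies; no named fact):

* `decOf D₃ O fuel₃`, `lenOf coins₃` (the subroutine's decision on `⟨u, c⟩` and its tape length), **`decKernel_eq_oracleLWEDistinguisher`**;
* `widthK/widthR/widthKR/sliceW/threshT` (the coin widths and the threshold denominator), **`tRecOf q m₃ c cD c₃ coins₃ n`** (the genuine record) with
  its field lemmas, `rRecW_tRecOf` (the row record of guess `w` is the genuine row record with multiplier `κ̂_w`);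
* `tQueryOf_tRecOf_fst_row`, `tQueryOf_tRecOf_fst_ref`, `tQuery_tRecOf_snd`, `slice_eq_chunk`, **`progBit_eq_answerBit`** (the program's answer
  bit of query `j` is the closed form on the `j`-th chunk), **`uniformVector_map_tVerdict`**
  (on uniform coins of length `≥ W·(G·N + N)` the program's verdict samples `machTest … (decKernel …)`), **`uniformVector_map_tVerdict_alg`**
  (with `D₃`: samples `machTest … (oracleLWEDistinguisher D₃ O coins₃ fuel₃ n (q n) (m₃ n))`).

## References

* Z. Brakerski, A. Langlois, C. Peikert, O. Regev, D. Stehlé, *Classical hardness of learning with errors*, STOC 2013; arXiv:1306.0281,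
  Lemma 2.15 (proof sketch) with Cor. 3.2 and §5. [BrakerskiEtAl2013]
* S. Arora, B. Barak, *Computational Complexity: A Modern Approach*, CUP 2009, Def. 7.1, §3.4. [AroraBarak2009]
-/

noncomputable section

open scoped ENNReal
open Polynomial PMF Literature.Probability.Distributions Literature.Algebra.EuclideanLattices Literature.Computability.Complexity

namespace Literature.Computability.Cryptography

namespace BLPRS2013

namespace KProg

open GaussRejMachine LWE LWE.MP12 LWE.MP12.Prog

/-! ### The subroutine's decision and its law -/

section Dec

variable (D₃ : OracleAlg Bool) (O : Oracle) (coins₃ fuel₃ : Polynomial ℕ)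

/-- **The decision of `D₃` on the subroutine input `⟨u, c⟩`** (time-out read as `0`). [cite: AroraBarak2009, §3.4 with Def. 7.1] -/
def decOf (u c : List Bool) : Bool := (D₃.run O (fuel₃.eval u.length) (boolPair u c)).getD false

/-- The length of `D₃`'s tape on input `u`. [cite: AroraBarak2009, Def. 7.1] -/
def lenOf (u : List Bool) : ℕ := coins₃.eval u.length

/-- **The decision law on a block is the tree's `oracleLWEDistinguisher`.** [cite: AroraBarak2009, Def. 7.1] -/
theorem decKernel_eq_oracleLWEDistinguisher {n q m : ℕ} [NeZero q] (y : Fin m → (Fin n → ZMod q) × ZMod q) :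
    decKernel (decOf D₃ O fuel₃) (lenOf coins₃) y = oracleLWEDistinguisher D₃ O coins₃ fuel₃ n q m y := by
  have key : ∀ u u' : List Bool, u = u' →
      (uniformOfFintype (List.Vector Bool (coins₃.eval u.length))).map
          (fun cs => (D₃.run O (fuel₃.eval u.length) (boolPair u cs.toList)).getD false) =
        (uniformOfFintype (List.Vector Bool (coins₃.eval u'.length))).map
          (fun cs => (D₃.run O (fuel₃.eval u'.length) (boolPair u' cs.toList)).getD false) := by
    rintro u _ rfl; rfl
  unfold decKernel decOf lenOf oracleLWEDistinguisher
  rw [OracleAlg.randRun_eq_map, PMF.map_comp]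
  exact key _ _ (ldataE_toLData y)

end Dec

/-! ### The genuine test record -/

section Record

variable (q m₃ : ℕ → ℕ) (c cD c₃ : ℕ) (coins₃ : Polynomial ℕ) (n : ℕ)

/-- Kernel coins per row call: `n·L + m₃·C₁`. [folklore] -/
def widthK : ℕ := n * resL q n + m₃ n * sampleWidth n (rejP n) (rejW c n) (rejR n) (jitP n) (PGParams.std (pgM n) (pgB n))

/-- Reference coins per block: `m₃·(n+1)·L`. [folklore] -/
def widthR : ℕ := m₃ n * ((n + 1) * resL q n)

/-- Offset of the subroutine's coins: `W_k + W_r` (at least both). [folklore] -/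
def widthKR : ℕ := widthK q m₃ c n + widthR q m₃ n

/-- Slice width: the offset plus the subroutine's tape on the longest block code. [folklore] -/
def sliceW : ℕ := widthKR q m₃ c n + coins₃.eval (ldataBound n (q n) (m₃ n))

/-- Threshold denominator `T = 4n^{c₃+1}` (`θ = 1/T = advThreshold (c₃+1) n`). [cite: BrakerskiEtAl2013, Lemma 2.15] -/
def threshT : ℕ := 4 * n ^ (c₃ + 1)

/-- **The genuine test record of level `n`.** [cite: BrakerskiEtAl2013, Lemma 2.15 with §5] -/
def tRecOf : TRec :=
  (rRecOf (gridTheta c n) (rejS n) (rejN n) (rejP n) (rejW c n) (rejR n) (q n) (modulus n) 0 (pgB n) (jitP n) (PGParams.std (pgM n) (pgB n)) (resL q n) n,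
    ((q n, (resL q n, n, m₃ n)),
      ((gridA c n, gridD cD n),
        ((gridG q cD n, gridBatches q cD c₃ n, gridBatches q cD c₃ n, m₃ n),
          ((widthK q m₃ c n, widthR q m₃ n, widthKR q m₃ c n, coins₃.eval (ldataBound n (q n) (m₃ n)), sliceW q m₃ c coins₃ n), threshT c₃ n)))))

/-- The genuine record's number of guesses. [folklore] -/
@[simp] theorem tRecOf_nG : (tRecOf q m₃ c cD c₃ coins₃ n).nG = gridG q cD n := rfl
/-- The genuine record's number of batches. [folklore] -/
@[simp] theorem tRecOf_nN : (tRecOf q m₃ c cD c₃ coins₃ n).nN = gridBatches q cD c₃ n := rfl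
/-- The genuine record's number of reference runs. [folklore] -/
@[simp] theorem tRecOf_nN' : (tRecOf q m₃ c cD c₃ coins₃ n).nN' = gridBatches q cD c₃ n := rfl
/-- The genuine record's block size. [folklore] -/
@[simp] theorem tRecOf_m3 : (tRecOf q m₃ c cD c₃ coins₃ n).m3 = m₃ n := rfl
/-- The genuine record's kernel coins per row call. [folklore] -/
@[simp] theorem tRecOf_wk : (tRecOf q m₃ c cD c₃ coins₃ n).wk = widthK q m₃ c n := rfl
/-- The genuine record's reference coins per block. [folklore] -/
@[simp] theorem tRecOf_wr : (tRecOf q m₃ c cD c₃ coins₃ n).wr = widthR q m₃ n := rfl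
/-- The genuine record's offset of the subroutine's coins. [folklore] -/
@[simp] theorem tRecOf_wkr : (tRecOf q m₃ c cD c₃ coins₃ n).wkr = widthKR q m₃ c n := rfl
/-- The genuine record's slice width. [folklore] -/
@[simp] theorem tRecOf_ww : (tRecOf q m₃ c cD c₃ coins₃ n).ww = sliceW q m₃ c coins₃ n := rfl
/-- The genuine record's threshold denominator. [folklore] -/
@[simp] theorem tRecOf_tt : (tRecOf q m₃ c cD c₃ coins₃ n).tt = threshT c₃ n := rfl
/-- The genuine record's dimension. [folklore] -/
@[simp] theorem tRecOf_dimN : (tRecOf q m₃ c cD c₃ coins₃ n).dimN = n := rfl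
/-- The genuine record's modulus. [folklore] -/
@[simp] theorem tRecOf_modQ : (tRecOf q m₃ c cD c₃ coins₃ n).modQ = q n := rfl
/-- The genuine record's reference record. [folklore] -/
@[simp] theorem tRecOf_fr : (tRecOf q m₃ c cD c₃ coins₃ n).fr = (q n, (resL q n, n, m₃ n)) := rfl
/-- The genuine record's grid base. [folklore] -/
@[simp] theorem tRecOf_gA : (tRecOf q m₃ c cD c₃ coins₃ n).gA = gridA c n := rfl
/-- The genuine record's grid fineness. [folklore] -/
@[simp] theorem tRecOf_gD : (tRecOf q m₃ c cD c₃ coins₃ n).gD = gridD cD n := rfl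

/-- The grid multiplier as one fraction: `κ̂_w = (A·D + w)/D` (`n ≥ 1`). [folklore] -/
theorem kappaHat_eq_div (hn : 0 < n) (w : ℕ) : kappaHat c cD n w = (((gridA c n * gridD cD n + w : ℕ) : ℤ) : ℚ) / (gridD cD n : ℚ) := by
  have hD : (gridD cD n : ℚ) ≠ 0 := by
    have h8 := gridD_ge (cD := cD) hn
    exact_mod_cast (show gridD cD n ≠ 0 by omega)
  unfold kappaHat
  field_simp
  push_cast
  ring

/-- **The row record of guess `w` is the genuine row record with multiplier `κ̂_w`** (`n ≥ 1`). [cite: BrakerskiEtAl2013, §5] -/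
theorem rRecW_tRecOf (hn : 0 < n) (w : ℕ) :
    rRecW (tRecOf q m₃ c cD c₃ coins₃ n) w =
      rRecOf (gridTheta c n) (rejS n) (rejN n) (rejP n) (rejW c n) (rejR n) (q n) (modulus n) (kappaHat c cD n w) (pgB n) (jitP n)
        (PGParams.std (pgM n) (pgB n)) (resL q n) n := by
  rw [kappaHat_eq_div c cD n hn]
  rfl

/-- `θ = 1/T`. [folklore] -/
theorem advThreshold_eq_one_div_threshT : advThreshold (c₃ + 1) n = 1 / (threshT c₃ n : ℝ) := by
  unfold advThreshold threshT
  push_cast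
  ring

/-- `T > 0` for `n ≥ 1`. [folklore] -/
theorem threshT_pos (hn : 0 < n) : 0 < threshT c₃ n := by
  unfold threshT; positivity

end Record

/-! ### The programs sample `machTest` -/

section Bridge

variable (q m₃ : ℕ → ℕ) [∀ n, NeZero (q n)] (c cD c₃ : ℕ) (coins₃ : Polynomial ℕ) (n : ℕ)
  (dec : List Bool → List Bool → Bool)

/-- **The program's answer bit of query `j`**: the decision on the code of the query's first field with the query's coins. [folklore] -/
def progBit (items : List LItem) (coins : List Bool) (j : ℕ) : Bool :=
  dec (ldataE (tQuery (tRecOf q m₃ c cD c₃ coins₃ n) coins₃ items coins j).1) (tQuery (tRecOf q m₃ c cD c₃ coins₃ n) coins₃ items coins j).2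

variable {q m₃ c cD c₃ coins₃ n dec}

omit [∀ n, NeZero (q n)] in
/-- **The row query at the genuine record**: for `j < G·N`, the first field is the switched block `(j / N, j % N)` with multiplier `κ̂_{j/N}`.
[cite: BrakerskiEtAl2013, Lemma 2.15 with §5] -/
theorem tQueryOf_tRecOf_fst_row (hn : 0 < n)
    (S : Fin (gridG q cD n * (gridBatches q cD c₃ n * m₃ n)) → (Fin n → ZMod (modulus n)) × ZMod (modulus n)) (coins : List Bool) {j : ℕ}
    (h : j < gridG q cD n * gridBatches q cD c₃ n) (hNb : 0 < gridBatches q cD c₃ n) :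
    (tQueryOf (tRecOf q m₃ c cD c₃ coins₃ n) (List.ofFn fun k => toItem (S k)) coins j).1 =
      (n, (q n, rowFlat (gridTheta c n) (rejS n) (rejN n) (rejP n) (rejW c n) (rejR n) (q n) (modulus n) (kappaHat c cD n (j / gridBatches q cD c₃ n))
        (pgB n) (jitP n) (PGParams.std (pgM n) (pgB n)) (resL q n) n
        (List.ofFn fun i => toItem (blocksOf (gridBatches q cD c₃ n) (m₃ n) (blocksOf (gridG q cD n) (gridBatches q cD c₃ n * m₃ n) S
          ⟨j / gridBatches q cD c₃ n, (Nat.div_lt_iff_lt_mul hNb).2 h⟩) ⟨j % gridBatches q cD c₃ n, Nat.mod_lt _ hNb⟩ i))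
        (((coins.drop (j * sliceW q m₃ c coins₃ n)).take (sliceW q m₃ c coins₃ n)).take (widthK q m₃ c n)))) := by
  have hcond : j < (tRecOf q m₃ c cD c₃ coins₃ n).nG * (tRecOf q m₃ c cD c₃ coins₃ n).nN := h
  unfold tQueryOf
  rw [if_pos hcond]
  show ((tRecOf q m₃ c cD c₃ coins₃ n).dimN, ((tRecOf q m₃ c cD c₃ coins₃ n).modQ,
      rowOf (rRecW (tRecOf q m₃ c cD c₃ coins₃ n) (j / gridBatches q cD c₃ n))
        (blockOf (gridBatches q cD c₃ n) (m₃ n) (List.ofFn fun k => toItem (S k)) (j / gridBatches q cD c₃ n) (j % gridBatches q cD c₃ n),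
          ((coins.drop (j * sliceW q m₃ c coins₃ n)).take (sliceW q m₃ c coins₃ n)).take (widthK q m₃ c n)))) = _
  rw [rRecW_tRecOf q m₃ c cD c₃ coins₃ n hn, rowOf_rRecOf,
    blockOf_ofFn S toItem ⟨j / gridBatches q cD c₃ n, (Nat.div_lt_iff_lt_mul hNb).2 h⟩ ⟨j % gridBatches q cD c₃ n, Nat.mod_lt _ hNb⟩]
  rfl

omit [∀ n, NeZero (q n)] in
/-- **The reference query at the genuine record**: for `j ≥ G·N`, the first field is a reference block. [cite: BrakerskiEtAl2013, Lemma 2.15] -/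
theorem tQueryOf_tRecOf_fst_ref (items : List LItem) (coins : List Bool) {j : ℕ} (h : ¬ j < gridG q cD n * gridBatches q cD c₃ n) :
    (tQueryOf (tRecOf q m₃ c cD c₃ coins₃ n) items coins j).1 =
      (n, (q n, refFlat (q n) (resL q n) n (m₃ n) (((coins.drop (j * sliceW q m₃ c coins₃ n)).take (sliceW q m₃ c coins₃ n)).take (widthR q m₃ n)))) := by
  have hcond : ¬ j < (tRecOf q m₃ c cD c₃ coins₃ n).nG * (tRecOf q m₃ c cD c₃ coins₃ n).nN := h
  unfold tQueryOf
  rw [if_neg hcond]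
  show ((tRecOf q m₃ c cD c₃ coins₃ n).dimN, ((tRecOf q m₃ c cD c₃ coins₃ n).modQ,
      refOf (tRecOf q m₃ c cD c₃ coins₃ n).fr (((coins.drop (j * sliceW q m₃ c coins₃ n)).take (sliceW q m₃ c coins₃ n)).take (widthR q m₃ n)))) = _
  rw [tRecOf_fr, refOf_eq]
  rfl

omit [∀ n, NeZero (q n)] in
/-- The second field of `tQuery` at the genuine record. [folklore] -/
theorem tQuery_tRecOf_snd (items : List LItem) (coins : List Bool) (j : ℕ) :
    (tQuery (tRecOf q m₃ c cD c₃ coins₃ n) coins₃ items coins j).2 =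
      ((((coins.drop (j * sliceW q m₃ c coins₃ n)).take (sliceW q m₃ c coins₃ n))).drop (widthKR q m₃ c n)).take
        (lenOf coins₃ (ldataE (tQueryOf (tRecOf q m₃ c cD c₃ coins₃ n) items coins j).1)) := rfl

/-- The program's slice is the `j`-th chunk. [folklore] -/
theorem slice_eq_chunk (W : ℕ) (coins : List Bool) (j : ℕ) : (coins.drop (j * W)).take W = chunk W coins j := by
  rw [chunk, Nat.mul_comm]

omit [∀ n, NeZero (q n)] in
/-- **The program's answer bit is the closed form on the `j`-th chunk** (`n ≥ 1`). [cite: BrakerskiEtAl2013, Lemma 2.15 (proof sketch)] -/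
theorem progBit_eq_answerBit (hn : 0 < n) (S : Fin (gridG q cD n * (gridBatches q cD c₃ n * m₃ n)) → (Fin n → ZMod (modulus n)) × ZMod (modulus n))
    (coins : List Bool) (j : ℕ) :
    progBit q m₃ c cD c₃ coins₃ n dec (List.ofFn fun k => toItem (S k)) coins j =
      answerBit (q' := q n) (gridTheta c n) (rejS n) (rejN n) (rejP n) (rejW c n) (rejR n) (pgB n) (jitP n) (PGParams.std (pgM n) (pgB n)) (resL q n)
        (widthK q m₃ c n) (widthR q m₃ n) (widthKR q m₃ c n) dec (lenOf coins₃) (gridBatches q cD c₃ n) (fun w => kappaHat c cD n w) S j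
        (chunk (sliceW q m₃ c coins₃ n) coins j) := by
  unfold progBit
  rw [tQuery_tRecOf_snd, tQuery_fst, ← slice_eq_chunk]
  unfold answerBit
  by_cases h : j < gridG q cD n * gridBatches q cD c₃ n
  · have hNb : 0 < gridBatches q cD c₃ n := Nat.pos_of_ne_zero fun h0 => by simp [h0] at h
    rw [dif_pos h, tQueryOf_tRecOf_fst_row hn S coins h hNb]
    rfl
  · rw [dif_neg h, tQueryOf_tRecOf_fst_ref _ coins h]
    rfl

/-- The subroutine's tape fits in the slice: `W_kr + coins₃(|code y|) ≤ W`. [folklore] -/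
theorem lenOf_le_sliceW_sub (y : Fin (m₃ n) → (Fin n → ZMod (q n)) × ZMod (q n)) :
    lenOf coins₃ (ldataE (toLData y)) ≤ sliceW q m₃ c coins₃ n - widthKR q m₃ c n := by
  unfold lenOf sliceW
  rw [Nat.add_sub_cancel_left, ldataE_toLData]
  exact TM2Iter.eval_mono coins₃ (length_encodeLWESamples_le_ldataBound y)

/-- **On uniform coins the program's verdict samples `machTest … (decKernel dec (lenOf coins₃))`** (`n ≥ 1`, coins of length `≥ W·(G·N + N)`).
[cite: BrakerskiEtAl2013, Lemma 2.15 (proof sketch) with Cor. 3.2 and §5; AroraBarak2009, Def. 7.1] -/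
theorem uniformVector_map_tVerdict (hn : 0 < n)
    (S : Fin (gridG q cD n * (gridBatches q cD c₃ n * m₃ n)) → (Fin n → ZMod (modulus n)) × ZMod (modulus n)) {C : ℕ}
    (hC : sliceW q m₃ c coins₃ n * (gridG q cD n * gridBatches q cD c₃ n + gridBatches q cD c₃ n) ≤ C) :
    (uniformOfFintype (List.Vector Bool C)).map (fun v => tVerdictOf (tRecOf q m₃ c cD c₃ coins₃ n)
      (List.ofFn fun j : Fin (gridG q cD n * gridBatches q cD c₃ n + gridBatches q cD c₃ n) =>
        progBit q m₃ c cD c₃ coins₃ n dec (List.ofFn fun k => toItem (S k)) v.toList j)) =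
      machTest q m₃ c cD c₃ n (decKernel dec (lenOf coins₃)) S := by
  have h := uniformVector_map_verdict (Q := modulus n) (q' := q n) (gridTheta c n) (rejS n) (rejN n) (rejP n) (rejW c n) (rejR n) (pgB n) (jitP n)
    (PGParams.std (pgM n) (pgB n)) (resL q n) dec (lenOf coins₃) (fun w => kappaHat c cD n w)
    (Wk := widthK q m₃ c n) (Wr := widthR q m₃ n) (Wkr := widthKR q m₃ c n) (W := sliceW q m₃ c coins₃ n)
    (Nb := gridBatches q cD c₃ n) (N' := gridBatches q cD c₃ n) rfl rfl (Nat.le_add_right _ _) (Nat.le_add_left _ _) (Nat.le_add_right _ _)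
    (lenOf_le_sliceW_sub (q := q) (m₃ := m₃) (c := c) (coins₃ := coins₃) (n := n)) (tRecOf q m₃ c cD c₃ coins₃ n)
    (tRecOf_nG q m₃ c cD c₃ coins₃ n) (tRecOf_nN q m₃ c cD c₃ coins₃ n) (tRecOf_nN' q m₃ c cD c₃ coins₃ n) (tRecOf_tt q m₃ c cD c₃ coins₃ n)
    (threshT_pos c₃ n hn) S hC
  simp only [progBit_eq_answerBit hn]
  rw [show (fun v : List.Vector Bool C => tVerdictOf (tRecOf q m₃ c cD c₃ coins₃ n)
      (List.ofFn fun j : Fin (gridG q cD n * gridBatches q cD c₃ n + gridBatches q cD c₃ n) =>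
        answerBit (q' := q n) (gridTheta c n) (rejS n) (rejN n) (rejP n) (rejW c n) (rejR n) (pgB n) (jitP n) (PGParams.std (pgM n) (pgB n)) (resL q n)
          (widthK q m₃ c n) (widthR q m₃ n) (widthKR q m₃ c n) dec (lenOf coins₃) (gridBatches q cD c₃ n) (fun w => kappaHat c cD n w) S j
          (chunk (sliceW q m₃ c coins₃ n) v.toList j))) =
      (fun v : List.Vector Bool C => tVerdictOf (tRecOf q m₃ c cD c₃ coins₃ n)
      (List.ofFn fun j : Fin (gridG q cD n * gridBatches q cD c₃ n + gridBatches q cD c₃ n) =>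
        answerBit (q' := q n) (gridTheta c n) (rejS n) (rejN n) (rejP n) (rejW c n) (rejR n) (pgB n) (jitP n) (PGParams.std (pgM n) (pgB n)) (resL q n)
          (widthK q m₃ c n) (widthR q m₃ n) (widthKR q m₃ c n) dec (lenOf coins₃) (gridBatches q cD c₃ n) (fun w => kappaHat c cD n w) S j
          (chunks (sliceW q m₃ c coins₃ n) _ hC v j).toList)) from rfl, h]
  unfold machTest machGridRow machRefBlock machRefSample
  rw [advThreshold_eq_one_div_threshT]
  rfl

/-- **With the decision algorithm `D₃` the program's verdict samples `machTest … (oracleLWEDistinguisher D₃ O coins₃ fuel₃ n (q n) (m₃ n))`.**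
[cite: BrakerskiEtAl2013, Lemma 2.15 (proof sketch) with Cor. 3.2 and §5; AroraBarak2009, Def. 7.1 with §3.4] -/
theorem uniformVector_map_tVerdict_alg (D₃ : OracleAlg Bool) (O : Oracle) (fuel₃ : Polynomial ℕ) (hn : 0 < n)
    (S : Fin (gridG q cD n * (gridBatches q cD c₃ n * m₃ n)) → (Fin n → ZMod (modulus n)) × ZMod (modulus n)) {C : ℕ}
    (hC : sliceW q m₃ c coins₃ n * (gridG q cD n * gridBatches q cD c₃ n + gridBatches q cD c₃ n) ≤ C) :
    (uniformOfFintype (List.Vector Bool C)).map (fun v => tVerdictOf (tRecOf q m₃ c cD c₃ coins₃ n)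
      (List.ofFn fun j : Fin (gridG q cD n * gridBatches q cD c₃ n + gridBatches q cD c₃ n) =>
        progBit q m₃ c cD c₃ coins₃ n (decOf D₃ O fuel₃) (List.ofFn fun k => toItem (S k)) v.toList j)) =
      machTest q m₃ c cD c₃ n (oracleLWEDistinguisher D₃ O coins₃ fuel₃ n (q n) (m₃ n)) S := by
  rw [uniformVector_map_tVerdict hn S hC]
  congr 1
  funext y
  exact decKernel_eq_oracleLWEDistinguisher D₃ O coins₃ fuel₃ y

end Bridge

end KProg

end BLPRS2013

end Literature.Computability.Cryptography

end
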